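import Summits.QuantumFields.YangMills.Theorems.UnitScaleTiltHistoryTailLaneTailV4Chi
import Summits.QuantumFields.YangMills.Theorems.AlphaInputsT3ACv4RecordSelXs
import HarnessLib

/-!
# `UnitScaleTiltHistoryTailLaneTailV4ChiDisplays` — crux `HistoryTailL` (stmt-QuantumFields-19936): THE CRUX FROM THE VERSION-4 χ-DISPLAY OF RECORD AND FROM THE ONE-CURRENCY
# SUPPLIER ROWS, BY NAME (P20 of bill v1.2 §7, ★★OWNER RULING g26-№14 (F-2b); twin of ✓`…LaneTailChiDisplays` ∕ ✓`HistoryTailOneSupplier.historyTailL_of_thm1In8_dataRows_allL` over the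
# v4 door) — cell `ym3-torus`, width seat ym-ust-19936-w3 (g5)

WHAT THE KERNEL NOW SAYS, end to end.  The v4 door `HistoryTailLaneTailV4Chi.historyTailL_of_laneRecordsV4Chi` (`(∀ L, Odd L → 1 < L → AlphaInputsT3ACv4RecChi L) → HistoryTailL`,
P19) composed with ★alpha-2's v4 display knits of ✓`AlphaInputsT3ACv4RecordSelXs` (P4) gives `HistoryTailL`
* `historyTailL_of_pinnedPartsRecSelXsV4Chi` — from ONE displayed predicate per odd block size `L > 1`: `AlphaInputsT3AC.PinnedPartsT3ACRecSelXsV4Chi L` = (T) [Balaban1985Variational]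
  Thm 1 `Thm1GlobalMinAt` · the record sizes · the seam row (71)_sym `SmallFactor71OfRecT3` (currency-free (71) per recorded plaquette — NO comb letter, NO (FL), NO collar) · (O‴χₛ) ONE
  measurable minimiser selection in `𝒞_Xs` with its Sect. B–C χ-data (`alphaInputsT3ACv4RecChi_of_pinnedPartsRecSelXsV4Chi`);
* ★★★ `historyTailL_of_thm1In8_selXsV4DataRows_allL` — THE ONE-SUPPLIER v4 DOOR: `HistoryTailL` ⇐ ⟨the registered 19200-side text `stub_thm1In8GlobalMin` for every odd `L > 1`⟩ ∧
  ⟨NODE O's v4 supplier rows `hrows` VERBATIM as displayed by `HistoryTailSelSupplier.laneRecordsV4Chi_of_thm1In8_selXsDataRows_allL`⟩ (that theorem, then the door);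
(The banked v3 text still closes through the v4 door — `historyTailL_of_laneRecordsV4Chi ∘ alphaInputsT3ACv4RecChi_of_v3` — which is ✓`historyTailL_of_laneRecordsChi`'s statement, so it is not restated.)
HONEST FRAMING.  One-line compositions of landed theorems; the displayed predicates and `hrows` are HYPOTHESIS SCHEMAS (never asserted) — «19936 PROVED MODULO the v4 display ∕ modulo
⟨T8⟩ ∧ ⟨NODE O's rows⟩», not a proof of the crux; nothing of [Balaban1985UV3]'s cluster expansion or [Balaban1985Variational] Thm 1 is proved; count-neutral helper
(`--supports stmt-QuantumFields-19936`); registry untouched (v5p10 is LEAD's crux-workfile act).  YM₃ on the three-torus is rung R3 of the programme, not the Clay problem; no claim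
about d = 4, infinite volume, or a mass gap.
[cite: Balaban1985UV3, (5) p.256, (47) p.267, (67)–(71) p.273 and Thm 2 p.272; Balaban1985Variational, Thm 1 (6)–(8) pp.278–279 and Prop 8 p.304; King1986, (3.12) p.657]
-/

set_option autoImplicit false

noncomputable section

open Literature.MathematicalPhysics.QuantumFieldTheory.Balaban1983to89
open Literature.MathematicalPhysics.QuantumFieldTheory.Balaban1983to89.T3ContinuumYM3Torus
open Literature.MathematicalPhysics.QuantumFieldTheory.Balaban1983to89.T3PrintedMinimiserExistence (Thm1GlobalMinAt)
open Literature.MathematicalPhysics.QuantumFieldTheory.Balaban1983to89.T3LowerAlongMinimisersSplit (MinimisersIn8At)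
open Literature.MathematicalPhysics.QuantumFieldTheory.Balaban1983to89.ExpMeanLog (deltaSU)
open Literature.MathematicalPhysics.QuantumFieldTheory.Balaban1985CMP102
open Literature.MathematicalPhysics.QuantumFieldTheory.Balaban1985CMP102.Setting
open Summit.QuantumFields.Balaban3D.Carriers
open Summit.QuantumFields.Balaban3D.Proofs.Primitives
open Summit.QuantumFields.Balaban3D.Proofs.Thresholds (Q0)
open Summit.QuantumFields.YangMills.Theorems
open Summit.QuantumFields.YangMills.Theorems.HistoryTailSelSupplier (laneRecordsV4Chi_of_thm1In8_selXsDataRows_allL)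
open B7Prop2Explicit (C0)

namespace Summit.QuantumFields.YangMills.Theorems.HistoryTailLaneTailV4Chi

/-- **`HistoryTailL` FROM THE VERSION-4 χ-DISPLAY OF RECORD**: if for every odd `L > 1` the displayed predicate `PinnedPartsT3ACRecSelXsV4Chi L` holds — (T) + record sizes + the seam row
(71)_sym + (O‴χₛ) one selection in `𝒞_Xs` — then the crux holds (`historyTailL_of_laneRecordsV4Chi ∘ alphaInputsT3ACv4RecChi_of_pinnedPartsRecSelXsV4Chi`).
[cite: Balaban1985UV3, (5) p.256, (47) p.267 and (71) p.273; Balaban1985Variational, Thm 1 (8) p.279] -/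
theorem historyTailL_of_pinnedPartsRecSelXsV4Chi
    (h : ∀ L : ℕ, Odd L → 1 < L → AlphaInputsT3AC.PinnedPartsT3ACRecSelXsV4Chi L) :
    Summit.QuantumFields.YangMills.Theses.UnitScaleTilt.HistoryTailL :=
  historyTailL_of_laneRecordsV4Chi fun L hLo hL => alphaInputsT3ACv4RecChi_of_pinnedPartsRecSelXsV4Chi (h L hLo hL)

/-- ★★★ **THE ONE-SUPPLIER VERSION-4 DOOR — `HistoryTailL` ⇐ ⟨`stub_thm1In8GlobalMin`'s TEXT at every odd `L > 1`⟩ ∧ ⟨NODE O's v4 supplier rows⟩**: the hypotheses are VERBATIM those of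
`HistoryTailSelSupplier.laneRecordsV4Chi_of_thm1In8_selXsDataRows_allL` (a floor `B₀` and a box `(0, A₀] × (0, A₁]` per odd `L`, on which the record rows, the seam row (71)_sym and one
measurable minimiser selection in `𝒞_Xs` with its Sect. B–C χ-data are served); the conclusion is the item stmt-QuantumFields-19936 BY NAME.  CONDITIONAL — nothing of the two displayed
inputs is proved here. [cite: Balaban1985UV3, (5) p.256, (47) p.267, (67)–(71) p.273 and Thm 2 p.272; Balaban1985Variational, Thm 1 (6)–(8) pp.278–279 and Prop 8 p.304] -/
theorem historyTailL_of_thm1In8_selXsV4DataRows_allL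
    (hT8 : ∀ L : ℕ, Odd L → 1 < L → ∃ a₀ a₁ B₃ : ℝ, 0 < a₀ ∧ 0 < a₁ ∧ 0 < B₃ ∧
      Thm1GlobalMinAt L a₀ a₁ B₃ ∧ MinimisersIn8At L a₀ a₁ B₃)
    (hrows : ∀ L : ℕ, Odd L → 1 < L → ∃ (B₀ A₀ A₁ : ℝ), 0 < A₀ ∧ 0 < A₁ ∧
      ∀ (B a₀ a₁ : ℝ), B₀ ≤ B → 1 ≤ 2 * B → 0 < a₀ → a₀ ≤ A₀ → 0 < a₁ → a₁ ≤ A₁ → B * a₁ ≤ a₀ →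
        (143 * ((((3 + 4 : ℕ) : ℝ)) ^ 2 / 4) ^ 2) * (2 * (B * a₁)) ≤ 1 / 3 →
        2 * (2 * (B * a₁)) ≤ 2 * deltaSU (Fin 2) / (((3 + 4) * L : ℕ) : ℝ) ^ 2 →
        Thm1GlobalMinAt L a₀ a₁ B →
        ∃ (b₁ p₁ : ℝ), ∀ (b₀ p₀ : ℝ), b₁ ≤ b₀ → p₁ ≤ p₀ →
          ∃ 𝔠 : AlphaConsts L (suGroupModel 2).N, 𝔠.b₀ = b₀ ∧ 𝔠.p₀ = p₀ ∧ 𝔠.B₃ = B ∧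
            4 * 𝔠.B₃ * (L : ℝ) ^ 2 * avgWindowFactor L ≤ 𝔠.C68 ∧
            Real.exp (𝔠.p₀ - 1) ≤ 3 * C0 3 * 𝔠.C68 * (𝔠.b₀ * Q0 𝔠.p₀) ∧
            (𝔠.b₀ * Q0 𝔠.p₀) * (2 * (L : ℝ) ^ 2 * avgWindowFactor L) ^ 2 ≤ 3 * C0 3 * 𝔠.C68 * a₁ ^ 2 ∧
            ∀ (F : T3Family) (hF : F.L = L),
              (∀ (γ : ℝ) (hγ : 0 < γ) (hγ1 : γ ≤ (min (hF ▸ 𝔠).gamma0 1) ^ 2) (K : ℕ),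
                AlphaInputsT3AC.SmallFactor71OfRecT3 F (hF ▸ 𝔠) γ hγ hγ1 K) ∧
              ∀ (γ : ℝ) (hγ : 0 < γ) (hγ1 : γ ≤ (min (hF ▸ 𝔠).gamma0 1) ^ 2) (K : ℕ),
                (∃ Ut : (k : ℕ) → GaugeField (F.P K) k (Matrix.specialUnitaryGroup (Fin 2) ℂ) →
                    GaugeField (F.P K) 0 (Matrix.specialUnitaryGroup (Fin 2) ℂ),
                  AlphaInputsT3AC.TrivMinimiserRowsT3 F (hF ▸ 𝔠) γ hγ hγ1 a₀ a₁ K Ut) →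
                ∃ Ut : (k : ℕ) → GaugeField (F.P K) k (Matrix.specialUnitaryGroup (Fin 2) ℂ) →
                    GaugeField (F.P K) 0 (Matrix.specialUnitaryGroup (Fin 2) ℂ),
                  AlphaInputsT3AC.TrivMinimiserRowsT3 F (hF ▸ 𝔠) γ hγ hγ1 a₀ a₁ K Ut ∧
                    AlphaInputsT3AC.DataRowsT3XsChiSel F (hF ▸ 𝔠) γ hγ hγ1 K Ut) :
    Summit.QuantumFields.YangMills.Theses.UnitScaleTilt.HistoryTailL :=
  historyTailL_of_laneRecordsV4Chi (laneRecordsV4Chi_of_thm1In8_selXsDataRows_allL hT8 hrows)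

end Summit.QuantumFields.YangMills.Theorems.HistoryTailLaneTailV4Chi

end
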